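import Mathlib
import HarnessLib
import Summits.Ventures.LatticeQCDFlow.Exactness.SUNJitteredHMCExactStep
import Summits.Ventures.LatticeQCDFlow.Exactness.SpreadingKernelDoeblin

/-!
# The engine's jittered `SU(N)` HMC as run, NAMED, and its Doeblin certificates — alone, followed by ANY exact step, followed by any Cabibbo–Marinari over-relaxation schedule

HONEST FRAMING: exact (Metropolis-corrected) sampling algorithms for lattice gauge theory;
figures of merit are autocorrelation/cost numbers at stated couplings and volumes; no
continuum-physics claim.

Venture `LatticeQCDFlow` (cell pub-lqcd), topic `Exactness`, FANOUT row 9 (eng-latcore, GEN-23; the engine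
`latflow.core.hmc.HMC(f, β, 'leapfrog').trajectory(τ, nstep, tau_jitter = j)` and `updates.composite_sweep(f, β,
'hmc', n_or)`).  NEW WORK of the cell over the tree, nothing cited as a fact, no number claimed: GEN-22's
`SUNJitteredLeapfrogHMC.lean` / `JitteredHMC.lean` / `SUNJitteredHMCExactStep.lean` (the jittered kernel
`sunJitterHMCN`, exact for every jitter law; `engine_sunLeapfrogHMCN_nHit_minorised_of_trajLength`,
`jitterHMC_nHit_minorised_of_atom`, `smul_frozen_le_jitterHMC`, `engine_sunLeapfrogHMCN_box_minorised_of_trajLength`),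
`ExactStepBoxMinorised.lean` / `SpreadingKernelDoeblin.lean` (`spreads_of_box_minorised`, `exists_nHit_comp_minorised`),
`CabibboMarinariORSweep.lean` (`cmORSweep_invariant`).  Printed counterparts NAMED ONLY: Mackenzie 1989 (randomised
trajectory lengths); Meyn–Tweedie 1993 ch. 16 (the `m`-skeleton Doeblin condition).

WHY.  GEN-22's convergence theorems (`wilson_sunWilsonForceJitterHMC_uniformlyErgodic`, `…_exactStep_…`,
`…_orSweep_…`) keep the Doeblin power INSIDE the proof.  The cell's figures of merit — `τ_int` of sector
indicators and bounded observables, error bars of time averages, burn-in — follow from a CERTIFICATE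
`ε' • ν ≤ K^m(U, ·)` (all `U`) through the tree's `…_of_nHit` theorems (rows 8, 13, 21).  This file gives the
engine's jittered kernel a NAME and states the three certificates; `SUNJitteredHMCFiguresOfMerit.lean` draws the
consequences.

## Content (torus `(ℤ/L)^d`, `G = SU(N)`, `N, L ≥ 1`, any real `β`; `π = wilsonMeasure (β/N)`)

* §0 `exactStep_nHit_minorised_of_box_minorised` — the Doeblin power behind `ExactStepBoxMinorised.lean`, STATED:
  a box-minorised update followed by ANY exact Markov step `P` has `a • π_w ≤ (P ∘ₖ K)^{mm+1}(U, ·)` for all `U`.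
* §1 **`wilsonJitterHMC N d L β nstep τ η`** — THE ENGINE'S JITTERED `SU(N)` HMC KERNEL AS RUN (the engine's
  coordinates, kinetic term, Wilson force law `sunWilsonForceLaw N β`, half kick `−(τ_l/2nstep_l)·F`, Metropolis
  test on `(β/N)·S_W + T`; labels `l ∼ η` on a countable set — the code's `u` is a 53-bit uniform); Markov
  (`isMarkovKernel_wilsonJitterHMC`); `wilsonJitterHMC_invariant` — exact for EVERY `nstep`, `τ`, `η` (GEN-22).
* §2 **`wilsonJitterHMC_certificate`** — `∃ τ₀ > 0` (on `N, d, L, β` only; not computed): for EVERY `nstep`, `τ`,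
  `η` and EVERY atom `l₀` (`η{l₀} ≠ 0`, `nstep l₀ ≥ 1`, `0 < τ l₀ ≤ τ₀`) some power `K^m` (`m > 0`) dominates
  `ε' · Haar^{⊗E}` from every configuration, `0 < ε' ≤ 1`; **`wilsonJitterHMC_exactStep_certificate`** — for
  EVERY Markov `P` leaving `π` invariant, `P ∘ₖ K` leaves `π` invariant and `ε' • π ≤ (P ∘ₖ K)^m(U, ·)` for all `U`;
  **`wilsonJitterHMC_orSweep_certificate`** (`L ≥ 2`; `P` = ANY schedule of Cabibbo–Marinari over-relaxation
  hits, i.e. the engine's `'hmc' (jittered) + n_or × 'or'` as run).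

NOT CLAIMED: any value of `τ₀, m, ε'` (compactness constants); atomless jitter laws; every atom long; OMF words;
floating point.
-/

noncomputable section

namespace Summit.Ventures.LatticeQCDFlow.Exactness

open MeasureTheory ProbabilityTheory ProbabilityTheory.Kernel Set Metric Function Filter Topology
open Literature.MathematicalPhysics.QuantumFieldTheory
open Literature.MathematicalPhysics.QuantumLattice (fundamentalRep continuous_fundamentalRep connectedSpace_specialUnitaryGroup)
open scoped ENNReal Matrix Matrix.Norms.Operator NNReal

set_option backward.isDefEq.respectTransparency false

/-! ## §0 The Doeblin power of a box-minorised update followed by any exact step, stated -/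

section Box

variable {ι : Type*} [Fintype ι] {G : Type*} [TopologicalSpace G] [Group G] [IsTopologicalGroup G]
  [CompactSpace G] [MeasurableSpace G] [BorelSpace G] [SecondCountableTopology G]
  [TopologicalSpace.PseudoMetrizableSpace G] [ConnectedSpace G] {w : (ι → G) → ℝ} {m M : ℝ}

/-- **THE DOEBLIN POWER OF A BOX-MINORISED UPDATE FOLLOWED BY ANY EXACT STEP** (`G` compact connected
second-countable pseudo-metrisable; `π_w = Z⁻¹ w · Haar^{⊗ι}`, `0 < m ≤ w ≤ M`; `κ • (⊗Haar)|_{box(U)} ≤ K U` for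
all `U`, one open `V' ∋ 1`, one `κ ≠ 0`; `P` ANY Markov kernel leaving `π_w` invariant): `a • π_w ≤ (P ∘ₖ K)^{mm+1}(U, ·)`
for some `mm`, `a ≠ 0` and EVERY `U` — the certificate the tree's `…_of_nHit` theorems consume. -/
theorem exactStep_nHit_minorised_of_box_minorised (hm : 0 < m) (hwm : ∀ U, m ≤ w U) (hwM : ∀ U, w U ≤ M)
    {K : Kernel (ι → G) (ι → G)} {V' : Set G} (hV'o : IsOpen V') (hV'1 : (1 : G) ∈ V') {κ : ℝ≥0∞} (hκ : κ ≠ 0)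
    (hbox : ∀ U : ι → G,
      κ • (Measure.pi fun _ : ι => haarProbability G).restrict {W | ∀ j, W j * (U j)⁻¹ ∈ V'} ≤ K U)
    (P : Kernel (ι → G) (ι → G)) [IsMarkovKernel P]
    (hP : Invariant P (gibbsProbability (Measure.pi fun _ : ι => haarProbability G) w)) :
    ∃ mm : ℕ, ∃ a : ℝ≥0∞, a ≠ 0 ∧ ∀ U : ι → G,
      a • gibbsProbability (Measure.pi fun _ : ι => haarProbability G) w ≤ nHit (P ∘ₖ K) (mm + 1) U := by
  letI : PseudoMetricSpace G := TopologicalSpace.pseudoMetrizableSpacePseudoMetric G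
  obtain ⟨r, hr, c, hc, hK, hpos⟩ := spreads_of_box_minorised (ι := ι) hm hwm hwM hV'o hV'1 hκ hbox
  haveI := isProbabilityMeasure_gibbsProbability (μ := Measure.pi fun _ : ι => haarProbability G) hm hwm hwM
  exact exists_nHit_comp_minorised hP hr hc hK hpos

end Box

/-! ## §1 The engine's jittered `SU(N)` HMC kernel as run, named; its certificates -/

section Kernel

variable (N d L : ℕ) [NeZero L]
variable {Lab : Type*} [Countable Lab] [MeasurableSpace Lab] [MeasurableSingletonClass Lab]

/-- **THE ENGINE'S JITTERED `SU(N)` HMC KERNEL AS RUN** (`hmc.HMC(f, β, 'leapfrog').trajectory(τ, nstep, tau_jitter)`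
on the torus `(ℤ/L)^d`): refresh the momenta (coordinates `sunCoordι N`, kinetic term `−Σ tr P²`, Gaussian law) and
an independent label `l ∼ η`; `nstep l` P-first leapfrog steps of size `τ l / nstep l` with THE ENGINE'S half kick
`−(τ l/2 nstep l)·F(U)`, `F(U) = sunWilsonForceLaw N β (coeConfig U)`; Metropolis test on `(β/N)·S_W + T`; forget
momenta and label.  (GEN-22's `sunJitterHMCN`, named.) -/
def wilsonJitterHMC (β : ℝ) (nstep : Lab → ℕ) (τ : Lab → ℝ) (η : Measure Lab) :
    Kernel (GaugeConfig d L (Matrix.specialUnitaryGroup (Fin N) ℂ)) (GaugeConfig d L (Matrix.specialUnitaryGroup (Fin N) ℂ)) :=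
  sunJitterHMCN (sunCoordι N) (sunCoordι_skew N) (Measure.addHaar : Measure (SUNCoords N)) (sunKinetic N)
    (fun l => τ l / nstep l)
    (fun l => measurable_halfKick_sun N (measurable_sunWilsonForceLaw_coeConfig N (d := d) (L := L) β) (τ l / nstep l))
    (fun U => β / N * wilsonAction (fundamentalRep (Fin N)) U) nstep η

variable {N d L}

/-- The jittered kernel is Markov (every probability law `η` on the labels). -/
instance isMarkovKernel_wilsonJitterHMC (β : ℝ) (nstep : Lab → ℕ) (τ : Lab → ℝ) (η : Measure Lab)
    [IsProbabilityMeasure η] : IsMarkovKernel (wilsonJitterHMC N d L β nstep τ η) := by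
  haveI := isProbabilityMeasure_sunMomentumLaw (L := Edge d L) (Measure.addHaar : Measure (SUNCoords N)) (sunKinetic N)
    (measurable_sunKinetic N) (sunMomentumWeight_sunKinetic_ne_top N Measure.addHaar)
  unfold wilsonJitterHMC sunJitterHMCN
  exact isMarkovKernel_jitterHMC _ _ η _ (measurable_engineWilsonAction N β) (measurable_sunKinetic N)

/-- The Wilson measure `wilsonMeasure (β/N)` for the fundamental representation is a probability law. -/
instance isProbabilityMeasure_wilsonMeasure_fundamentalRep (β : ℝ) :
    IsProbabilityMeasure (wilsonMeasure (d := d) (L := L) (fundamentalRep (Fin N)) β) :=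
  isProbabilityMeasure_wilsonMeasure _ (continuous_fundamentalRep (Fin N)) β

/-- **EXACT FOR EVERY JITTER LAW** (GEN-22, restated for the named kernel): `wilsonMeasure (β/N)` is invariant
for EVERY `nstep`, EVERY `τ`, EVERY probability law `η`. -/
theorem wilsonJitterHMC_invariant (β : ℝ) (nstep : Lab → ℕ) (τ : Lab → ℝ) (η : Measure Lab)
    [IsProbabilityMeasure η] :
    Invariant (wilsonJitterHMC N d L β nstep τ η) (wilsonMeasure (d := d) (L := L) (fundamentalRep (Fin N)) (β / N)) :=
  wilson_sunWilsonForceJitterHMC_invariant N β nstep τ η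

end Kernel

/-! ## §2 The certificates -/

section Certificates

variable {N d L : ℕ} [NeZero N] [NeZero L] (β : ℝ)
variable {Lab : Type*} [Countable Lab] [MeasurableSpace Lab] [MeasurableSingletonClass Lab]

/-- **THE DOEBLIN CERTIFICATE OF THE ENGINE'S JITTERED `SU(N)` HMC AS RUN.**  There is `τ₀ > 0` (on `N, d, L, β`
only; not computed) such that for EVERY step-number assignment `nstep`, EVERY length assignment `τ`, EVERY jitter
law `η` and EVERY label `l₀` with `η{l₀} ≠ 0`, `nstep l₀ ≥ 1`, `0 < τ l₀ ≤ τ₀`: some power `K^m` (`m > 0`)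
dominates `ε' · Haar^{⊗E}` from EVERY configuration, `0 < ε' ≤ 1`. -/
theorem wilsonJitterHMC_certificate :
    ∃ τ₀ : ℝ, 0 < τ₀ ∧ ∀ (nstep : Lab → ℕ) (τ : Lab → ℝ) (η : Measure Lab) [IsProbabilityMeasure η] (l₀ : Lab),
      1 ≤ nstep l₀ → η {l₀} ≠ 0 → 0 < τ l₀ → τ l₀ ≤ τ₀ →
      ∃ m : ℕ, ∃ ε' : ℝ≥0∞, 0 < m ∧ 0 < ε' ∧ ε' ≤ 1 ∧
        ∀ U : GaugeConfig d L (Matrix.specialUnitaryGroup (Fin N) ℂ),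
          ε' • Measure.pi (fun _ : Edge d L => haarProbability (Matrix.specialUnitaryGroup (Fin N) ℂ)) ≤
            nHit (wilsonJitterHMC N d L β nstep τ η) m U := by
  obtain ⟨s, hs⟩ := exists_bound_smul_wilsonAction_sun N (d := d) (L := L) _ (continuous_fundamentalRep (Fin N)) (β / N)
  obtain ⟨Fmax, KF, hF0, hKF0, hFb, hFK⟩ := sunWilsonForceLaw_bounds N (d := d) (L := L) β
  obtain ⟨τ₀, hτ₀, hmin⟩ := engine_sunLeapfrogHMCN_nHit_minorised_of_trajLength N
    (measurable_sunWilsonForceLaw_coeConfig N (d := d) (L := L) β) hF0 hFb hKF0 hFK (measurable_engineWilsonAction N β) hs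
  refine ⟨τ₀, hτ₀, fun nstep τ η _ l₀ hn hl₀ hτl hτl₀ => ?_⟩
  have hn0 : (0 : ℝ) < nstep l₀ := by exact_mod_cast hn
  obtain ⟨k, δ, hδ, hpow⟩ :=
    hmin (nstep l₀) (τ l₀ / nstep l₀) hn (div_pos hτl hn0) (by rwa [mul_div_cancel₀ _ hn0.ne'])
  haveI := isProbabilityMeasure_sunMomentumLaw (L := Edge d L) (Measure.addHaar : Measure (SUNCoords N)) (sunKinetic N)
    (measurable_sunKinetic N) (sunMomentumWeight_sunKinetic_ne_top N Measure.addHaar)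
  have hminJ := jitterHMC_nHit_minorised_of_atom (η := η)
    (μP := sunMomentumLaw (Measure.addHaar : Measure (SUNCoords N)) (sunKinetic N))
    (hΦ := measurable_jitterMap_of_countable fun l => measurable_sunLeapfrogProposalN (sunCoordι N)
      (sunCoordι_skew N) (τ l / nstep l) (nstep l)
      (measurable_halfKick_sun N (measurable_sunWilsonForceLaw_coeConfig N (d := d) (L := L) β) (τ l / nstep l)))
    (S := fun U => β / N * wilsonAction (fundamentalRep (Fin N)) U)
    (measurable_engineWilsonAction N β) (measurable_sunKinetic N) l₀ (k := k)
    (fun u => by simpa only [sunLeapfrogHMCN] using hpow u)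
  have ha0 : η {l₀} ^ (k + 1) * δ ≠ 0 := mul_ne_zero (pow_ne_zero _ hl₀) hδ.ne'
  haveI : IsMarkovKernel (nHit (wilsonJitterHMC N d L β nstep τ η) (k + 1)) := isMarkovKernel_nHit _ _
  have hminJ' : ∀ U : GaugeConfig d L (Matrix.specialUnitaryGroup (Fin N) ℂ),
      (η {l₀} ^ (k + 1) * δ) • Measure.pi (fun _ : Edge d L => haarProbability (Matrix.specialUnitaryGroup (Fin N) ℂ)) ≤
        nHit (wilsonJitterHMC N d L β nstep τ η) (k + 1) U :=
    fun U => by simpa only [wilsonJitterHMC, sunJitterHMCN] using hminJ U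
  have ha1 : η {l₀} ^ (k + 1) * δ ≤ 1 := by
    have h1 := Measure.le_iff'.1 (hminJ' fun _ => 1) univ
    rwa [Measure.smul_apply, smul_eq_mul, measure_univ, measure_univ, mul_one] at h1
  exact ⟨k + 1, η {l₀} ^ (k + 1) * δ, Nat.succ_pos k, pos_iff_ne_zero.2 ha0, ha1, hminJ'⟩

/-- **THE DOEBLIN CERTIFICATE OF THE JITTERED ENGINE HMC FOLLOWED BY ANY EXACT STEP.**  There is `τ₀ > 0`
(on `N, d, L, β` only) such that for EVERY `nstep`, `τ`, `η`, atom `l₀` (`η{l₀} ≠ 0`, `nstep l₀ ≥ 1`,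
`0 < τ l₀ ≤ τ₀`) and EVERY Markov kernel `P` leaving `wilsonMeasure (β/N)` invariant: `P ∘ₖ K_jit` leaves
`wilsonMeasure (β/N)` invariant and some power of it dominates `ε' · wilsonMeasure (β/N)` from EVERY
configuration (`m > 0`, `0 < ε' ≤ 1`). -/
theorem wilsonJitterHMC_exactStep_certificate :
    ∃ τ₀ : ℝ, 0 < τ₀ ∧ ∀ (nstep : Lab → ℕ) (τ : Lab → ℝ) (η : Measure Lab) [IsProbabilityMeasure η] (l₀ : Lab),
      1 ≤ nstep l₀ → η {l₀} ≠ 0 → 0 < τ l₀ → τ l₀ ≤ τ₀ →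
      ∀ (P : Kernel (GaugeConfig d L (Matrix.specialUnitaryGroup (Fin N) ℂ))
          (GaugeConfig d L (Matrix.specialUnitaryGroup (Fin N) ℂ))) [IsMarkovKernel P],
        Invariant P (wilsonMeasure (d := d) (L := L) (fundamentalRep (Fin N)) (β / N)) →
      Invariant (P ∘ₖ wilsonJitterHMC N d L β nstep τ η) (wilsonMeasure (d := d) (L := L) (fundamentalRep (Fin N)) (β / N)) ∧
      ∃ m : ℕ, ∃ ε' : ℝ≥0∞, 0 < m ∧ 0 < ε' ∧ ε' ≤ 1 ∧
        ∀ U : GaugeConfig d L (Matrix.specialUnitaryGroup (Fin N) ℂ),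
          ε' • wilsonMeasure (d := d) (L := L) (fundamentalRep (Fin N)) (β / N) ≤
            nHit (P ∘ₖ wilsonJitterHMC N d L β nstep τ η) m U := by
  haveI : ConnectedSpace (Matrix.specialUnitaryGroup (Fin N) ℂ) := connectedSpace_specialUnitaryGroup
  obtain ⟨s, hs⟩ := exists_bound_smul_wilsonAction_sun N (d := d) (L := L) _ (continuous_fundamentalRep (Fin N)) (β / N)
  obtain ⟨Fmax, KF, hF0, hKF0, hFb, hFK⟩ := sunWilsonForceLaw_bounds N (d := d) (L := L) β
  obtain ⟨τ₀, hτ₀, hbox⟩ := engine_sunLeapfrogHMCN_box_minorised_of_trajLength N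
    (measurable_sunWilsonForceLaw_coeConfig N (d := d) (L := L) β) hF0 hFb hKF0 hFK (measurable_engineWilsonAction N β) hs
  refine ⟨τ₀, hτ₀, fun nstep τ η _ l₀ hn hl₀ hτl hτl₀ P _ hP => ?_⟩
  have hn0 : (0 : ℝ) < nstep l₀ := by exact_mod_cast hn
  obtain ⟨V, hVo, hV1, κ, hκ, hK⟩ :=
    hbox (nstep l₀) (τ l₀ / nstep l₀) hn (div_pos hτl hn0) (by rwa [mul_div_cancel₀ _ hn0.ne'])
  haveI := isProbabilityMeasure_sunMomentumLaw (L := Edge d L) (Measure.addHaar : Measure (SUNCoords N)) (sunKinetic N)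
    (measurable_sunKinetic N) (sunMomentumWeight_sunKinetic_ne_top N Measure.addHaar)
  -- the jittered update dominates the atom's update, hence product Haar on the box
  have hboxJ : ∀ U : GaugeConfig d L (Matrix.specialUnitaryGroup (Fin N) ℂ),
      (η {l₀} * κ) • (Measure.pi fun _ : Edge d L => haarProbability (Matrix.specialUnitaryGroup (Fin N) ℂ)).restrict
          {W | ∀ j, W j * (U j)⁻¹ ∈ V} ≤ wilsonJitterHMC N d L β nstep τ η U := fun U =>
    calc (η {l₀} * κ) • (Measure.pi fun _ : Edge d L => haarProbability (Matrix.specialUnitaryGroup (Fin N) ℂ)).restrict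
            {W | ∀ j, W j * (U j)⁻¹ ∈ V}
        = η {l₀} • (κ • (Measure.pi fun _ : Edge d L => haarProbability (Matrix.specialUnitaryGroup (Fin N) ℂ)).restrict
            {W | ∀ j, W j * (U j)⁻¹ ∈ V}) := by rw [smul_smul]
      _ ≤ η {l₀} • sunLeapfrogHMCN (sunCoordι N) (sunCoordι_skew N) (τ l₀ / nstep l₀)
            (Measure.addHaar : Measure (SUNCoords N)) (sunKinetic N)
            (measurable_halfKick_sun N (measurable_sunWilsonForceLaw_coeConfig N (d := d) (L := L) β)
              (τ l₀ / nstep l₀)) (fun U => β / N * wilsonAction (fundamentalRep (Fin N)) U) (nstep l₀) U := by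
          refine Measure.le_iff'.2 fun A => ?_
          simp only [Measure.smul_apply, smul_eq_mul]
          exact mul_le_mul' le_rfl (Measure.le_iff'.1 (hK U) A)
      _ ≤ _ := by
          simpa only [wilsonJitterHMC, sunJitterHMCN, sunLeapfrogHMCN] using
            smul_frozen_le_jitterHMC (η := η) (μP := sunMomentumLaw (Measure.addHaar : Measure (SUNCoords N)) (sunKinetic N))
              (hΦ := measurable_jitterMap_of_countable fun l => measurable_sunLeapfrogProposalN (sunCoordι N)
                (sunCoordι_skew N) (τ l / nstep l) (nstep l)
                (measurable_halfKick_sun N (measurable_sunWilsonForceLaw_coeConfig N (d := d) (L := L) β) (τ l / nstep l)))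
              (S := fun U => β / N * wilsonAction (fundamentalRep (Fin N)) U)
              (measurable_engineWilsonAction N β) (measurable_sunKinetic N) l₀ U
  have hKinv := wilsonJitterHMC_invariant (N := N) (d := d) (L := L) β nstep τ η
  refine ⟨hP.comp hKinv, ?_⟩
  obtain ⟨hlo, hhi⟩ := gibbsWeight_pinched (L := Edge d L) (n := Fin N) hs
  have heq := gibbsProbability_smul_wilsonAction_eq N (d := d) (L := L) (fundamentalRep (Fin N)) (β / N)
  rw [← heq] at hP hKinv
  obtain ⟨mm, a, ha, hmin⟩ := exactStep_nHit_minorised_of_box_minorised (Real.exp_pos (-s)) hlo hhi hVo hV1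
    (mul_ne_zero hl₀ hκ) hboxJ P hP
  rw [heq] at hmin
  haveI : IsMarkovKernel (nHit (P ∘ₖ wilsonJitterHMC N d L β nstep τ η) (mm + 1)) := isMarkovKernel_nHit _ _
  have ha1 : a ≤ 1 := by
    have h1 := Measure.le_iff'.1 (hmin fun _ => 1) univ
    rwa [Measure.smul_apply, smul_eq_mul, measure_univ, measure_univ, mul_one] at h1
  exact ⟨mm + 1, a, Nat.succ_pos mm, pos_iff_ne_zero.2 ha, ha1, hmin⟩

variable {mC : Type*} [Fintype mC] [DecidableEq mC]

/-- **THE DOEBLIN CERTIFICATE OF THE ENGINE'S `'hmc' (WITH tau_jitter) + n_or × 'or'` COMPOSITE AS RUN**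
(`L ≥ 2`; `P` = ANY schedule `sched` of Cabibbo–Marinari over-relaxation hits, `cmORSweep sched`): same `τ₀`;
the composite leaves `wilsonMeasure (β/N)` invariant and some power of it dominates `ε' · wilsonMeasure (β/N)`
from EVERY configuration (`m > 0`, `0 < ε' ≤ 1`). -/
theorem wilsonJitterHMC_orSweep_certificate (hL : 2 ≤ L) :
    ∃ τ₀ : ℝ, 0 < τ₀ ∧ ∀ (nstep : Lab → ℕ) (τ : Lab → ℝ) (η : Measure Lab) [IsProbabilityMeasure η] (l₀ : Lab)
      (sched : List (Edge d L × (Fin N ≃ Fin 2 ⊕ mC))), 1 ≤ nstep l₀ → η {l₀} ≠ 0 → 0 < τ l₀ → τ l₀ ≤ τ₀ →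
      Invariant (cmORSweep sched ∘ₖ wilsonJitterHMC N d L β nstep τ η)
          (wilsonMeasure (d := d) (L := L) (fundamentalRep (Fin N)) (β / N)) ∧
      ∃ m : ℕ, ∃ ε' : ℝ≥0∞, 0 < m ∧ 0 < ε' ∧ ε' ≤ 1 ∧
        ∀ U : GaugeConfig d L (Matrix.specialUnitaryGroup (Fin N) ℂ),
          ε' • wilsonMeasure (d := d) (L := L) (fundamentalRep (Fin N)) (β / N) ≤
            nHit (cmORSweep sched ∘ₖ wilsonJitterHMC N d L β nstep τ η) m U := by
  obtain ⟨τ₀, hτ₀, h⟩ := wilsonJitterHMC_exactStep_certificate (N := N) (d := d) (L := L) (Lab := Lab) β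
  refine ⟨τ₀, hτ₀, fun nstep τ η _ l₀ sched hn hl₀ hτl hτl₀ =>
    h nstep τ η l₀ hn hl₀ hτl hτl₀ (cmORSweep sched) ?_⟩
  -- the OR schedule leaves the Wilson measure invariant
  rw [← gibbsProbability_smul_wilsonAction_eq N (d := d) (L := L) (fundamentalRep (Fin N)) (β / N)]
  refine invariant_gibbsProbability ?_
  have hdens : (fun U : GaugeConfig d L (Matrix.specialUnitaryGroup (Fin N) ℂ) =>
      ENNReal.ofReal (Real.exp (-(β / N * wilsonAction (fundamentalRep (Fin N)) U)))) =
      gibbsDensity fun U : GaugeConfig d L (Matrix.specialUnitaryGroup (Fin N) ℂ) => β / N * wilsonAction (suRep N) U := by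
    funext U; rfl
  rw [hdens]
  exact cmORSweep_invariant (β / N) hL sched

end Certificates

end Summit.Ventures.LatticeQCDFlow.Exactness

end
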